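import Summits.MatrixMultiplication.OmegaCensus.STPPVosperSlackOneSteps

/-!
# ω-census (abelian STPP census): the SLACK-1 VOSPER LAW at prime order, modulo the Hamidoune–Rødseth inverse theorem (kernel)

HONEST FRAMING (pub-omega census; verbatim): lottery ticket; floor = certified bounds/negative ranges.
Census STRUCTURE (seat pub-omega-stpp-1 gen 30, 2026-08-28), family (b2).  CONDITIONAL THEOREM FILTER: every use carries the hypothesis
`hHR : HamidouneRodsethInverseTheorem` (Hamidoune–Rødseth 2000, stated as printed in `STPPVosperSlackOneSteps.lean`, NOT proved in the tree).
Nothing here is progress on `ω`.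

## Statement (`no_isSTPP_of_slack_one_tables_prime`)

Notation of `STPPVosperTightStructure.lean` (`C`-reading of block `i` of an STPP family with non-empty sets in `ℤ/pℤ`, another block present):
`a = |Aᵢ|`, `b = |Bᵢ|`, `vol = aᵢbᵢcᵢ`, `z = Σ_{k≠i} a_k c_k`, `L = Σ_{k≠i} b_k c_k`.  If `a, b ≥ 3`, `z, L ≥ 4`, the N18 chain has SLACK ONE
(`z + b + vol + a + L = p + 1`), `m = L + a − 1`, `n = vol + m`, and the three finite tables hold — the tight-type window table for `(p, n, m, b)`
(as in `STPPVosperPrimeTableLaw`), `tableAlpha p (n+1) (m+2) b {0,1,p−1} = true` and `tableBeta p (n+1) m b {0,1,p−1} = true`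
(`STPPVosperSlackOneTools`) — then the family does not exist, PROVIDED the Hamidoune–Rødseth inverse theorem.

## Proof

Write `Sn = −Aᵢ`, `Y° = ⋃_{k≠i}(C_k − B_k)`, `W = {c − x − y}`, `V = W ⊔ (Sn + Y°)`, `Z°`; `|Sn + Y°| ≥ a + L − 1 = m`, `|Bᵢ + V| ≥ b + |V| − 1`,
`Bᵢ + V ⊆ H ∖ Z°` (`|…| ≤ p − z = b + n`).  Slack one leaves three cases.
(α) `|Sn + Y°| = m + 1`: then `|V| = n + 1`, `(Bᵢ, V)` is critical with `Bᵢ + V = H ∖ Z°`; Vosper: `Bᵢ`, `V` progressions of step `e′`; Hamidoune–Rødseth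
for `(Sn, Y°)` (`|Sn| = a ≥ 3`, `|Y°| = L ≥ 4`, `7 ≤ m + 1 ≤ p − 4`): `Sn ⊆ (a+1)`-, `Y° ⊆ (L+1)`-term progressions of one step `d`, so `Sn + Y°` is the
`(m+2)`-term progression of step `d` with one term removed (`eq_apErase_of_subset_apFinset`); `prefix_law_of_runs` + `val_mem_of_nat_table_erase_prime`.
(β) `|Sn + Y°| = m`, `|Bᵢ + V| = b + n`: Vosper for `(Sn, Y°)` (step `d`), Hamidoune–Rødseth for `(Bᵢ, V)` (`b ≥ 3`, `|V| = n`, `7 ≤ b + n = p − z ≤ p − 4`):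
`Bᵢ` = a `(b+1)`-term progression of step `e′` minus one term, `V` inside an `(n+1)`-term one; `holed_ratio_val_mem`.
(γ) `|Sn + Y°| = m`, `|Bᵢ + V| = b + n − 1`: Vosper twice; `prefix_law_of_runs` + `val_mem_of_nat_table_prime`.
In every case `(e′⁻¹ d).val ∈ {0, 1, p−1}`, so `d = ±e′` (`eq_or_eq_neg_of_ratio_val_mem`), and consecutive terms of `Aᵢ` (step `d`) and `Bᵢ`
(step `e′`) exist (`exists_adjacent_of_apErase`, `a, b ≥ 3`) and give the forbidden word (`false_of_adjacent_steps`).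

References: Y. O. Hamidoune, Ø. J. Rødseth, Acta Arith. 92 (2000) 251–262; O. Serra, G. Zémor, Integers 0 (2000) A10, Thm 3; A. G. Vosper, J. London
Math. Soc. 31 (1956); M. B. Nathanson, GTM 165, Thm 2.7; H. Cohn, R. Kleinberg, B. Szegedy, C. Umans, FOCS 2005 (arXiv:math/0511460), Def. 5.1.
-/

open Finset
open scoped Pointwise

namespace Summit.MatrixMultiplication.OmegaCensus.CubeNB

open Literature.Computability.AlgebraicComplexity
open Literature.Combinatorics.Additive
open Summit.MatrixMultiplication.OmegaCensus.STPPKneser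

variable {p : ℕ} [hp : Fact p.Prime]

/-- **The slack-1 Vosper law at prime order, modulo Hamidoune–Rødseth (kernel, general block).**  See the module docstring.
`hm : L + a = m + 1`, `hn : vol + m = n`, slack one `z + b + vol + a + L = p + 1`; the three tables are the only pattern-specific input.
[cite: CohnKleinbergSzegedyUmans2005, Def. 5.1] [cite: Vosper1956, main theorem; Nathanson1996, Thm 2.7]
[cite: HamidouneRodseth2000, main theorem (§1, p. 252); SerraZemor2000, Theorem 3] -/
theorem no_isSTPP_of_slack_one_tables_prime (hHR : HamidouneRodsethInverseTheorem) {N : ℕ} (A B C : Fin N → Finset (ZMod p))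
    (hS : IsSTPP A B C) (hA : ∀ k, (A k).Nonempty) (hB : ∀ k, (B k).Nonempty) (hC : ∀ k, (C k).Nonempty)
    (i : Fin N) (hI : ((univ : Finset (Fin N)).erase i).Nonempty)
    {a b vol z L m n : ℕ} (ha : #(A i) = a) (hb : #(B i) = b) (hvol : #(A i) * #(B i) * #(C i) = vol)
    (hz : ∑ k ∈ univ.erase i, #(A k) * #(C k) = z) (hL : ∑ k ∈ univ.erase i, #(B k) * #(C k) = L)
    (h3a : 3 ≤ a) (h3b : 3 ≤ b) (h4z : 4 ≤ z) (h4L : 4 ≤ L) (hslack : z + b + vol + a + L = p + 1)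
    (hm : L + a = m + 1) (hn : vol + m = n)
    (htableγ : ∀ j < p, ∀ t < p, (∀ i' < m, (t + j * i') % p < n) →
      (∀ k < m, b ∣ (t + j * k) % p - #((range m).filter fun i' => (t + j * i') % p < (t + j * k) % p)) →
      j ∈ ({0, 1, p - 1} : Finset ℕ))
    (htableα : tableAlpha p (n + 1) (m + 2) b {0, 1, p - 1} = true)
    (htableβ : tableBeta p (n + 1) m b {0, 1, p - 1} = true) : False := by
  have hp2 : 2 ≤ p := hp.out.two_le
  have hcardp : Fintype.card (ZMod p) = p := ZMod.card p
  -- the objects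
  set W := ((A i) ×ˢ ((B i) ×ˢ (C i))).image fun q : ZMod p × ZMod p × ZMod p => (0 : ZMod p) + q.2.2 - q.1 - q.2.1 with hW
  set Sn := (A i).image (fun x => (0 : ZMod p) - x) with hSn
  set Yo := DU B C (univ.erase i) with hYo
  set Zo := DU A C (univ.erase i) with hZo
  have hWcard : #W = vol := by rw [hW, card_image_blockSum hS i 0, hvol]
  have hSncard : #Sn = a := by rw [hSn, Finset.card_image_of_injective _ sub_right_injective, ha]
  have hYocard : #Yo = L := by rw [hYo, card_DU_BC hS hA, hL]
  have hZocard : #Zo = z := by rw [hZo, card_DU_AC hS hB, hz]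
  have hSnne : Sn.Nonempty := (hA i).image _
  have hYone : Yo.Nonempty := DU_nonempty hI hB hC
  have hWV : Disjoint W (Sn + Yo) := disjoint_W_negA_add_DU hS i
  have hVcard : #(W ∪ (Sn + Yo)) = vol + #(Sn + Yo) := by rw [Finset.card_union_of_disjoint hWV, hWcard]
  have hsub : B i + (W ∪ (Sn + Yo)) ⊆ univ \ Zo := B_add_W_union_negA_add_subset hS i
  have hvol1 : 1 ≤ vol := by rw [← hvol]; exact Nat.mul_pos (Nat.mul_pos (hA i).card_pos (hB i).card_pos) (hC i).card_pos
  have hU : #(univ \ Zo) = p - z := by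
    rw [Finset.card_sdiff_of_subset (Finset.subset_univ _), Finset.card_univ, hcardp, hZocard]
  have hzle : z ≤ p := by have h := Finset.card_le_univ Zo; rwa [hcardp, hZocard] at h
  have hBV_le : #(B i + (W ∪ (Sn + Yo))) ≤ p - z := hU ▸ Finset.card_le_card hsub
  -- Cauchy–Davenport twice
  have hWne : W.Nonempty := Finset.card_pos.1 (by rw [hWcard]; exact hvol1)
  have hSY_ne_univ : Sn + Yo ≠ univ := by
    intro h
    obtain ⟨x, hx⟩ := hWne
    exact Finset.disjoint_left.1 hWV hx (h ▸ Finset.mem_univ x)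
  have hcd1 : #Sn + #Yo ≤ #(Sn + Yo) + 1 := Vosper.cauchy_davenport_of_ne_univ hSnne hYone hSY_ne_univ
  have hZne : Zo.Nonempty := Finset.card_pos.1 (by rw [hZocard]; omega)
  have hVne : (W ∪ (Sn + Yo)).Nonempty := hWne.mono Finset.subset_union_left
  have hBV_ne_univ : B i + (W ∪ (Sn + Yo)) ≠ univ := by
    intro h
    obtain ⟨x, hx⟩ := hZne
    have := hsub (h ▸ Finset.mem_univ x)
    rw [Finset.mem_sdiff] at this
    exact this.2 hx
  have hcd2 : #(B i) + #(W ∪ (Sn + Yo)) ≤ #(B i + (W ∪ (Sn + Yo))) + 1 :=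
    Vosper.cauchy_davenport_of_ne_univ (hB i) hVne hBV_ne_univ
  rw [hSncard, hYocard] at hcd1
  rw [hb, hVcard] at hcd2
  -- numerology: #(Sn + Yo) ∈ {m, m+1}
  have hSYge : m ≤ #(Sn + Yo) := by omega
  have hSYle : #(Sn + Yo) ≤ m + 1 := by omega
  have hmp : m + 2 ≤ p - 4 := by omega
  -- adjacent pairs in Aᵢ from a structure statement on Sn
  have hApair : ∀ {s d : ZMod p} {k μ : ℕ}, 4 ≤ k → Sn = apErase s d k μ → ∃ α, α ∈ A i ∧ α + d ∈ A i := by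
    intro s d k μ hk hSnE
    obtain ⟨x, hx, hxd⟩ := exists_adjacent_of_apErase s d (μ := μ) hk
    rw [← hSnE] at hx hxd
    obtain ⟨α₁, hα₁, hα₁x⟩ := Finset.mem_image.1 hxd
    obtain ⟨α₂, hα₂, hα₂x⟩ := Finset.mem_image.1 hx
    refine ⟨α₁, hα₁, ?_⟩
    have : α₁ + d = α₂ := by
      have h1 : (0 : ZMod p) - α₁ = x + d := hα₁x
      have h2 : (0 : ZMod p) - α₂ = x := hα₂x
      linear_combination h2 - h1
    rw [this]; exact hα₂
  have hBpair : ∀ {β e' : ZMod p} {k μ : ℕ}, 4 ≤ k → B i = apErase β e' k μ → ∃ β₀, β₀ ∈ B i ∧ β₀ + e' ∈ B i := by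
    intro β e' k μ hk hBE
    obtain ⟨x, hx, hxe⟩ := exists_adjacent_of_apErase β e' (μ := μ) hk
    rw [← hBE] at hx hxe
    exact ⟨x, hx, hxe⟩
  rcases Nat.eq_or_lt_of_le hSYle with hαcase | hlt
  · /- Case α: the first Cauchy–Davenport step is loose. -/
    have hVn : #(W ∪ (Sn + Yo)) = n + 1 := by rw [hVcard, hαcase]; omega
    have hBVeq : #(B i + (W ∪ (Sn + Yo))) = p - z := by omega
    have hEq : B i + (W ∪ (Sn + Yo)) = univ \ Zo := Finset.eq_of_subset_of_card_le hsub (by rw [hU, hBVeq])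
    -- Vosper for (Bᵢ, V)
    have h2B : 2 ≤ #(B i) := by rw [hb]; omega
    have h2V : 2 ≤ #(W ∪ (Sn + Yo)) := by rw [hVn]; omega
    have hcrit2 : #(B i + (W ∪ (Sn + Yo))) = #(B i) + #(W ∪ (Sn + Yo)) - 1 := by rw [hb, hVn]; omega
    have hsmall2 : #(B i + (W ∪ (Sn + Yo))) ≤ p - 2 := by omega
    obtain ⟨e', he', hBap, hVap⟩ := vosper_inverse h2B h2V hcrit2 hsmall2
    obtain ⟨β, hβ⟩ := hBap
    obtain ⟨v, hv⟩ := hVap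
    rw [hb] at hβ; rw [hVn] at hv
    -- Hamidoune–Rødseth for (Sn, Yo)
    have hHR1 := hHR p Sn Yo (by rw [hSncard]; omega) (by rw [hYocard]; omega) (by omega) (by omega) (by omega)
    obtain ⟨d, s₀, y₀, hSsub, hYsub⟩ := hHR1
    rw [hSncard] at hSsub; rw [hYocard] at hYsub
    have hd : d ≠ 0 := step_ne_zero_of_subset_apFinset hSsub (by rw [hSncard]; omega)
    have hSYsub : Sn + Yo ⊆ apFinset (s₀ + y₀) d (m + 2) := by
      have h := (Finset.add_subset_add hSsub hYsub).trans (apFinset_add_apFinset_subset s₀ y₀ d (a + 1) (L + 1))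
      rwa [show a + 1 + (L + 1) - 1 = m + 2 by omega] at h
    obtain ⟨μ, hμ, hSYE⟩ := eq_apErase_of_subset_apFinset hd (by omega) hSYsub (by rw [hαcase])
    -- consecutive terms of Aᵢ (step d) and Bᵢ (step e′)
    obtain ⟨μ₁, -, hSnE⟩ := eq_apErase_of_subset_apFinset hd (by omega : a + 1 ≤ p) hSsub (by rw [hSncard])
    obtain ⟨α₀, hα₀, hα₀d⟩ := hApair (by omega) hSnE
    obtain ⟨b', rfl⟩ : ∃ b', b = b' + 1 := ⟨b - 1, by omega⟩
    have hβmem : β ∈ B i := by rw [hβ]; exact mem_apFinset.2 ⟨0, by omega, by simp⟩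
    have hβe : β + e' ∈ B i := by rw [hβ]; exact mem_apFinset.2 ⟨1, by omega, by simp⟩
    -- transport and table α
    obtain ⟨hSsub', hgap⟩ := prefix_law_of_runs hS i (SY := Sn + Yo) (N₁ := n + 1) he' hβ hWV hv (by omega)
    rw [hSYE, image_affine_apErase] at hSsub' hgap
    have hval := val_mem_of_nat_table_erase_prime (p := p) (n := n + 1) (m := m + 2) (r := b' + 1) (J := {0, 1, p - 1})
      (by omega) (by omega) (tableAlpha_spec htableα) (mul_ne_zero (inv_ne_zero he') hd) hμ hSsub' hgap
    have hpm := eq_or_eq_neg_of_ratio_val_mem hd he' hval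
    exact false_of_adjacent_steps hS i hα₀ hα₀d hβmem hβe (hC i) he' hpm
  · /- Cases β, γ: the first step is tight, Vosper for (Sn, Yo). -/
    have hSYm : #(Sn + Yo) = m := by omega
    have hVn : #(W ∪ (Sn + Yo)) = n := by rw [hVcard, hSYm, hn]
    have h2S : 2 ≤ #Sn := by rw [hSncard]; omega
    have h2Yo : 2 ≤ #Yo := by rw [hYocard]; omega
    have hcrit1 : #(Sn + Yo) = #Sn + #Yo - 1 := by rw [hSncard, hYocard]; omega
    have hsmall1 : #(Sn + Yo) ≤ p - 2 := by omega
    obtain ⟨d, hd, hSap, hYap⟩ := vosper_inverse h2S h2Yo hcrit1 hsmall1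
    obtain ⟨s₀, hs₀⟩ := hSap
    obtain ⟨y₀, hy⟩ := hYap
    rw [hSncard] at hs₀; rw [hYocard] at hy
    have hsubm : Sn + Yo ⊆ apFinset (s₀ + y₀) d m := by
      have h := apFinset_add_apFinset_subset s₀ y₀ d a L
      rw [show a + L - 1 = m by omega] at h
      rwa [hs₀, hy]
    have hSY : Sn + Yo = apFinset (s₀ + y₀) d m :=
      Finset.eq_of_subset_of_card_le hsubm (by rw [hSYm, card_apFinset hd (by omega)])
    -- consecutive terms of Aᵢ (step d): Sn is an a-term progression = (a+1)-term one minus its first term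
    have hSnE : Sn = apErase (s₀ - d) d (a + 1) 0 := by rw [hs₀, apFinset_eq_apErase_zero]
    obtain ⟨α₀, hα₀, hα₀d⟩ := hApair (by omega) hSnE
    rcases Nat.eq_or_lt_of_le hBV_le with hβcase | hγlt
    · /- Case β: the second Cauchy–Davenport step is loose; Hamidoune–Rødseth for (Bᵢ, V). -/
      have hEq : B i + (W ∪ (Sn + Yo)) = univ \ Zo := Finset.eq_of_subset_of_card_le hsub (by rw [hU, hβcase])
      have hHR2 := hHR p (B i) (W ∪ (Sn + Yo)) (by rw [hb]; omega) (by rw [hVn]; omega) (by omega) (by omega)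
        (by rw [hb, hVn]; omega)
      obtain ⟨e', β, v, hBsub, hVsub⟩ := hHR2
      rw [hb] at hBsub; rw [hVn] at hVsub
      have he' : e' ≠ 0 := step_ne_zero_of_subset_apFinset hBsub (by rw [hb]; omega)
      obtain ⟨g, hg, hBE⟩ := eq_apErase_of_subset_apFinset he' (by omega : b + 1 ≤ p) hBsub (by rw [hb])
      -- normalise the removed index away from the last slot
      obtain ⟨β₁, g₁, hg₁, hBE₁⟩ : ∃ β₁ : ZMod p, ∃ g₁ : ℕ, g₁ < b ∧ B i = apErase β₁ e' (b + 1) g₁ := by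
        rcases Nat.lt_or_ge g b with hgb | hgb
        · exact ⟨β, g, hgb, hBE⟩
        · have hgb' : g = b := by omega
          obtain ⟨b', rfl⟩ : ∃ b', b = b' + 1 := ⟨b - 1, by omega⟩
          refine ⟨β - e', 0, by omega, ?_⟩
          rw [hBE, hgb', apErase_last_eq_apErase_zero]
      obtain ⟨β₀, hβ₀, hβ₀e⟩ := hBpair (by omega) hBE₁
      -- table β
      have hPcard : #((A i) ×ˢ (C i)) ≤ n + 1 := by
        rw [Finset.card_product]
        have h1 : #(A i) * #(C i) ≤ #(A i) * #(B i) * #(C i) := by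
          rw [mul_assoc, mul_comm (#(B i)) _, ← mul_assoc]
          exact Nat.le_mul_of_pos_right _ (hB i).card_pos
        rw [hvol] at h1
        omega
      have hval := holed_ratio_val_mem hS i (J := {0, 1, p - 1}) he' hd hg₁ hBE₁ hSY hWV hVsub hVn (by omega) hPcard
        (tableBeta_spec htableβ)
      have hpm := eq_or_eq_neg_of_ratio_val_mem hd he' hval
      exact false_of_adjacent_steps hS i hα₀ hα₀d hβ₀ hβ₀e (hC i) he' hpm
    · /- Case γ: the inclusion is loose; Vosper for (Bᵢ, V). -/
      have hBVeq : #(B i + (W ∪ (Sn + Yo))) = b + n - 1 := by omega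
      have h2B : 2 ≤ #(B i) := by rw [hb]; omega
      have h2V : 2 ≤ #(W ∪ (Sn + Yo)) := by rw [hVn]; omega
      have hcrit2 : #(B i + (W ∪ (Sn + Yo))) = #(B i) + #(W ∪ (Sn + Yo)) - 1 := by rw [hb, hVn]; omega
      have hsmall2 : #(B i + (W ∪ (Sn + Yo))) ≤ p - 2 := by omega
      obtain ⟨e', he', hBap, hVap⟩ := vosper_inverse h2B h2V hcrit2 hsmall2
      obtain ⟨β, hβ⟩ := hBap
      obtain ⟨v, hv⟩ := hVap
      rw [hb] at hβ; rw [hVn] at hv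
      obtain ⟨b', rfl⟩ : ∃ b', b = b' + 1 := ⟨b - 1, by omega⟩
      have hβmem : β ∈ B i := by rw [hβ]; exact mem_apFinset.2 ⟨0, by omega, by simp⟩
      have hβe : β + e' ∈ B i := by rw [hβ]; exact mem_apFinset.2 ⟨1, by omega, by simp⟩
      obtain ⟨hSsub', hgap⟩ := prefix_law_of_runs hS i (SY := Sn + Yo) (N₁ := n) he' hβ hWV hv (by omega)
      rw [hSY, image_affine_apFinset] at hSsub' hgap
      have hval := val_mem_of_nat_table_prime (p := p) (n := n) (m := m) (r := b' + 1) (J := {0, 1, p - 1})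
        (by omega) (by omega) htableγ (mul_ne_zero (inv_ne_zero he') hd) hSsub' hgap
      have hpm := eq_or_eq_neg_of_ratio_val_mem hd he' hval
      exact false_of_adjacent_steps hS i hα₀ hα₀d hβmem hβe (hC i) he' hpm

end Summit.MatrixMultiplication.OmegaCensus.CubeNB
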